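import Summits.ResolutionOfSingularities.ResolutionOfSingularities.Theorems.PurelyInseparableDim4ValueCertGame
import Summits.ResolutionOfSingularities.ResolutionOfSingularities.Theorems.PurelyInseparableDim4InScopeWinCertFastN
import HarnessLib
import HarnessLib.Audit.Tags

/-!
# Purely inseparable fourfolds — VALUE CERTIFICATES `ρ = r` for the coordinate-centre game over a finite field
# [OURS · counted 0 · a certificate format for OUR frame, not about resolution]

Census cell «res-dim4-pi» (D-0157 DOOR 2), width seat `res-dim4-p-6` (g6), part 2 (sequel of
`PurelyInseparableDim4ValueCertGame`: `Game.WinsIn`, `ValueCert.ResWinsIn q β n s`), taking `res-dim4-idea-2` g11's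
offer (bus 2026-08-29 14:03:44Z; engine-free checker `tools-g11/check_cert.py`): an A-STRATEGY TABLE (state ↦ centre)
certifies «A forces the origin to stop being `q`-fold within `r` moves against every `K`-rational answer», a
B-STRATEGY TABLE (state × centre ↦ answer) certifies «B keeps the origin `q`-fold for `r − 1` rounds against EVERY
permissible coordinate centre»; together the VALUE is `r`.  The kernel format, `F`-keyed (the game reads `F` only,
`resWinsIn_congr`), depth-annotated and ORDER-FREE (a row may cite any row of its table; acyclicity comes from the
depths), over p-13's `StepKit` (`stepD`, `permB`), p-14's Hasse–Taylor test `equiHB` and p-10's `compactL`: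

* WIN rows `(L, S, d)` «from every state with `F = evalT L`, A wins within `d` moves, opening with `V(z, x_S)`»,
  check `wrowOK q β W`: origin not `q`-fold, or `d ≥ 1`, `S` permissible and every `β`-answer `(j, b)` (`j ∈ S`, all
  `b : Fin 4 → K` with `b_j = 0`, by `Fintype`) is rejected by `equiHB`, kills `F`, or has its compact child among the
  rows of `W` with depth `≤ d − 1` (same number of terms, then p-13's coefficient test `StepKit.equivB`);
* LOSS rows `(L, d, table)` «from every state with `F = evalT L`, A does NOT win within `d` moves», check
  `lrowOK q β T`: origin `q`-fold and, if `d ≥ 1`, for EVERY permissible `S` the table names a `β`-answer `(j, b)`,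
  `j ∈ S`, `b_j = 0`, whose compact child is `q`-fold (so the answer IS an equimultiple point), non-zero and among the
  rows of `T` with depth `≥ d − 1`;
* SOUNDNESS **`resWinsIn_of_wrowOK`** (strong induction on the depth) and **`not_resWinsIn_of_lrowOK`** (induction
  on the budget); root-centre readings `answers_win_of_wrowOK` (the row's centre opens a `d`-move win) and
  `exists_answer_not_win_of_lreplyOK` (a named answer refutes a centre: opening with it costs `≥ d + 2`);
* ACCEPTANCE (`decide`): idea-2's smallest anti-monotone pair, TRAVEL game over `𝔽₂` — `x₃x₄ + x₂²x₃x₄` has value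
  `2` (`value_small`; `certs-g11/small-travel-rho2.json`) while its shift `x₃x₄ + x₂²x₃³x₄` has value `1`
  (`value_smallShift`; `smallshift-travel-rho1.json`).

CAVEAT: `K`-rational answers over the finite `K` of the certificate only (a value over `𝔽₂` says nothing over `𝔽₄`);
statements about OUR frame's game; nothing here proves F4-C in any form or resolution of singularities in dimension
≥ 4 / characteristic `p`; counted 0; AI kernel work, weaker than expert review.
bears_on: LADDER-RESOLUTION:D157-DOOR2 (res-dim4-pi · value-certificate format, part 2). Supports
stmt-ResolutionOfSingularities-16155 (helper).
-/

set_option linter.dupNamespace false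

noncomputable section

namespace Summit.ResolutionOfSingularities.ResolutionOfSingularities.Theorems.PIDim4

namespace ValueCert

open MvPolynomial Finset
open Literature.AlgebraicGeometry.Resolution
open Literature.AlgebraicGeometry.Resolution.CentreBlowup
open StepKit WinCertSound InScopeWinCert LoopCLocal

variable {K : Type} [Field K] [DecidableEq K]

/-! ## 3. Value certificates over a finite field -/

section Cert

variable [Fintype K]

/-- The presented state `(L, r = 0, exc = ∅)` (the game reads `F` only). [folklore] -/
def sd (L : Terms 4 K) : SData 4 K := ⟨L, fun _ => 0, ∅⟩

omit [DecidableEq K] [Fintype K] in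
/-- Its `F` is `evalT L`. [folklore] -/
@[simp] theorem sd_toState_F (L : Terms 4 K) : (sd L).toState.F = evalT L := rfl

/-- A **win row** `(L, S, d)`: from every state with `F = evalT L` player A wins within `d` moves, opening with the
centre `V(z, x_S)` (ignored when the origin is not `q`-fold). [folklore] -/
abbrev WRow (K : Type) : Type := Terms 4 K × Finset (Fin 4) × ℕ

/-- A **loss row** `(L, d, table)`: from every state with `F = evalT L` player A does NOT win within `d` moves; the
table lists B's answer `(j, b)` to each permissible centre `S`. [folklore] -/
abbrev LRow (K : Type) : Type := Terms 4 K × ℕ × List (Finset (Fin 4) × Fin 4 × (Fin 4 → K))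

/-- The child `c` is among the win rows with depth `≤ d`. [folklore] -/
def wchildOK (W : List (WRow K)) (c : Terms 4 K) (d : ℕ) : Bool :=
  W.any fun r => decide (r.2.2 ≤ d) && (c.length == r.1.length && StepKit.equivB c r.1)

/-- B's `β`-answer `(j, b)` to `S` at `L` is harmless within the budget `d` for the children: outside the class,
rejected by the Hasse–Taylor equimultiplicity test, kills `F`, or its compact child is a win row of depth `≤ d`.
[folklore] -/
def wreplyOK (q : ℕ) (β : Finset (Fin 4) → Fin 4 → (Fin 4 → K) → Bool) (W : List (WRow K)) (L : Terms 4 K)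
    (S : Finset (Fin 4)) (d : ℕ) (j : Fin 4) (b : Fin 4 → K) : Bool :=
  !(β S j b) || !(equiHB q S j b (sd L)) ||
    (StepKit.equivB (compactL (stepD q S j b (sd L)).L) [] || wchildOK W (compactL (stepD q S j b (sd L)).L) d)

/-- **Win-row check**: the origin is not `q`-fold (won already), or `d ≥ 1`, the centre is permissible and every
`β`-answer is harmless within `d − 1`. [folklore] -/
def wrowOK (q : ℕ) (β : Finset (Fin 4) → Fin 4 → (Fin 4 → K) → Bool) (W : List (WRow K)) (row : WRow K) : Bool :=
  !(permB q Finset.univ row.1) ||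
    (decide (0 < row.2.2) && permB q row.2.1 row.1 &&
      decide (∀ j ∈ row.2.1, ∀ b : Fin 4 → K, b j = 0 → wreplyOK q β W row.1 row.2.1 (row.2.2 - 1) j b = true))

/-- The child `c` is among the loss rows with depth `≥ d`. [folklore] -/
def lchildOK (T : List (LRow K)) (c : Terms 4 K) (d : ℕ) : Bool :=
  T.any fun r => decide (d ≤ r.2.1) && (c.length == r.1.length && StepKit.equivB c r.1)

/-- The compact child `c` is a legal landing for B that survives `d` more rounds: origin `q`-fold (so the answer was an
equimultiple point), non-zero, and a loss row of depth `≥ d`. [folklore] -/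
def lchildStep (q : ℕ) (T : List (LRow K)) (d : ℕ) (c : Terms 4 K) : Bool :=
  permB q Finset.univ c && !(StepKit.equivB c []) && lchildOK T c d

/-- B's table entry `(j, b)` answers the centre `S` at `L` inside the class `β` and survives `d` more rounds.
[folklore] -/
def lreplyOK (q : ℕ) (β : Finset (Fin 4) → Fin 4 → (Fin 4 → K) → Bool) (T : List (LRow K)) (L : Terms 4 K)
    (d : ℕ) (S : Finset (Fin 4)) (jb : Fin 4 × (Fin 4 → K)) : Bool :=
  decide (jb.1 ∈ S) && decide (jb.2 jb.1 = 0) && β S jb.1 jb.2 &&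
    lchildStep q T d (compactL (stepD q S jb.1 jb.2 (sd L)).L)

/-- **Loss-row check**: the origin is `q`-fold (a legal move exists) and, if `d ≥ 1`, EVERY permissible centre has a
table answer surviving `d − 1` more rounds. [folklore] -/
def lrowOK (q : ℕ) (β : Finset (Fin 4) → Fin 4 → (Fin 4 → K) → Bool) (T : List (LRow K)) (row : LRow K) : Bool :=
  permB q Finset.univ row.1 &&
    (decide (row.2.1 = 0) ||
      decide (∀ S : Finset (Fin 4), permB q S row.1 = true →
        (row.2.2.any fun e => decide (e.1 = S) && lreplyOK q β T row.1 (row.2.1 - 1) S e.2) = true))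

/-! ### Soundness -/

omit [Fintype K] in
/-- The `F` of a child of a state with `F = evalT L` is presented by the compact child list. [folklore] -/
theorem step_F_eq_compact_child (q : ℕ) (S : Finset (Fin 4)) (j : Fin 4) (b : Fin 4 → K) {s : State K}
    {L : Terms 4 K} (hs : s.F = evalT L) :
    (step q S j b s).F = evalT (compactL (stepD q S j b (sd L)).L) := by
  rw [FlatAbsorb.step_F_congr q S j b (t := (sd L).toState) (by rw [hs, sd_toState_F]), step_toState,
    SData.toState_F, evalT_compactL]

omit [Fintype K] in
/-- A state with `F = evalT L` and `permB q univ L = false` has no permissible centre. [folklore] -/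
theorem no_permissible_of_permB_false {q : ℕ} {s : State K} {L : Terms 4 K} (hs : s.F = evalT L)
    (h : permB q Finset.univ L = false) : ∀ S : Finset (Fin 4), ¬ IsPermissibleCentre q S s.F := by
  intro S hS
  have huniv := (exists_isPermissibleCentre_iff_univ s.F).mp ⟨S, hS⟩
  rw [hs, isPermissibleCentre_iff, h] at huniv
  exact Bool.false_ne_true huniv

omit [Fintype K] in
/-- A state with `F = evalT L` and `permB q univ L = true` has a permissible centre. [folklore] -/
theorem exists_permissible_of_permB_true {q : ℕ} {s : State K} {L : Terms 4 K} (hs : s.F = evalT L)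
    (h : permB q Finset.univ L = true) : ∃ S : Finset (Fin 4), IsPermissibleCentre q S s.F :=
  ⟨Finset.univ, by rw [hs]; exact (isPermissibleCentre_iff q _ L).mpr h⟩

/-- **SOUNDNESS OF WIN ROWS.** If every row of `W` passes `wrowOK q β W`, then from every state presenting a row's
`F` player A wins the `β`-game within the row's depth. (Strong induction on the depth: cited children have smaller
depth.) [folklore] -/
theorem resWinsIn_of_wrowOK {q : ℕ} {β : Finset (Fin 4) → Fin 4 → (Fin 4 → K) → Bool} {W : List (WRow K)}
    (hW : ∀ row ∈ W, wrowOK q β W row = true) :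
    ∀ row ∈ W, ∀ s : State K, s.F = evalT row.1 → ResWinsIn q β row.2.2 s := by
  suffices key : ∀ n : ℕ, ∀ row ∈ W, row.2.2 = n → ∀ s : State K, s.F = evalT row.1 → ResWinsIn q β row.2.2 s from
    fun row hrow => key _ row hrow rfl
  intro n
  induction n using Nat.strong_induction_on with
  | _ n ih =>
  intro row hrow hn s hs
  have h := hW row hrow
  unfold wrowOK at h
  rw [Bool.or_eq_true] at h
  rcases h with hterm | hmove
  · rw [Bool.not_eq_true'] at hterm
    exact Game.WinsIn.terminal (no_permissible_of_permB_false hs hterm)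
  · rw [Bool.and_eq_true, Bool.and_eq_true, decide_eq_true_eq, decide_eq_true_eq] at hmove
    obtain ⟨⟨hd, hS⟩, hall⟩ := hmove
    obtain ⟨d, hd'⟩ : ∃ d, row.2.2 = d + 1 := ⟨row.2.2 - 1, by omega⟩
    rw [hd']
    refine Game.WinsIn.move (m := row.2.1) (by rw [hs]; exact (isPermissibleCentre_iff q _ _).mpr hS) ?_
    rintro s' ⟨j, b, hj, hbj, hβ, heq, hne, rfl⟩
    have h := hall j hj b hbj
    rw [hd', Nat.add_sub_cancel] at h
    unfold wreplyOK at h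
    rw [Bool.or_eq_true, Bool.or_eq_true, Bool.or_eq_true] at h
    have hF := step_F_eq_compact_child q row.2.1 j b hs
    have heq' : IsEquimultiplePoint q row.2.1 j b (sd row.1).toState :=
      (FlatAbsorb.isEquimultiplePoint_congr q row.2.1 j b (by rw [hs, sd_toState_F])).mp heq
    rcases h with (h0 | h1) | (h2 | h3)
    · rw [Bool.not_eq_true'] at h0
      rw [h0] at hβ
      exact absurd hβ Bool.false_ne_true
    · rw [Bool.not_eq_true'] at h1
      exact absurd (equiHB_of_isEquimultiplePoint heq') (by rw [h1]; exact Bool.false_ne_true)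
    · exact absurd (by rw [hF, (evalT_eq_iff_equivB _ _).mpr h2, evalT_nil]) hne
    · unfold wchildOK at h3
      obtain ⟨r, hr, hrc⟩ := List.any_eq_true.mp h3
      rw [Bool.and_eq_true, decide_eq_true_eq, Bool.and_eq_true] at hrc
      have hlt : r.2.2 < n := by omega
      have hrF : (step q row.2.1 j b s).F = evalT r.1 := by rw [hF]; exact (evalT_eq_iff_equivB _ _).mpr hrc.2.2
      exact (ih r.2.2 hlt r hr rfl _ hrF).mono hrc.1

omit [Fintype K] in
/-- **SOUNDNESS OF LOSS ROWS.** If every row of `T` passes `lrowOK q β T`, then from every state presenting a row's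
`F` player A does NOT win the `β`-game within the row's depth: B, answering by the table, keeps the origin `q`-fold.
(Induction on the budget: cited children have depth at least the budget left.) [folklore] -/
theorem not_resWinsIn_of_lrowOK {q : ℕ} {β : Finset (Fin 4) → Fin 4 → (Fin 4 → K) → Bool} {T : List (LRow K)}
    (hT : ∀ row ∈ T, lrowOK q β T row = true) :
    ∀ row ∈ T, ∀ s : State K, s.F = evalT row.1 → ¬ ResWinsIn q β row.2.1 s := by
  suffices key : ∀ n : ℕ, ∀ row ∈ T, n ≤ row.2.1 → ∀ s : State K, s.F = evalT row.1 → ¬ ResWinsIn q β n s from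
    fun row hrow => key _ row hrow le_rfl
  intro n
  induction n with
  | zero =>
    intro row hrow _ s hs
    have h := hT row hrow
    unfold lrowOK at h
    rw [Bool.and_eq_true] at h
    exact Game.not_winsIn_zero (exists_permissible_of_permB_true hs h.1)
  | succ k ih =>
    intro row hrow hk s hs
    have h := hT row hrow
    unfold lrowOK at h
    rw [Bool.and_eq_true, Bool.or_eq_true, decide_eq_true_eq, decide_eq_true_eq] at h
    obtain ⟨hperm, htab⟩ := h
    rcases htab with h0 | htab
    · omega
    refine Game.not_winsIn_succ (exists_permissible_of_permB_true hs hperm) fun S hS => ?_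
    have hS' : permB q S row.1 = true := by rw [hs] at hS; exact (isPermissibleCentre_iff q S row.1).mp hS
    obtain ⟨e, -, he⟩ := List.any_eq_true.mp (htab S hS')
    rw [Bool.and_eq_true, decide_eq_true_eq] at he
    obtain ⟨rfl, he⟩ := he
    unfold lreplyOK lchildStep at he
    simp only [Bool.and_eq_true, decide_eq_true_eq, Bool.not_eq_true'] at he
    obtain ⟨⟨⟨hj, hbj⟩, hβ⟩, ⟨hpc, hnz⟩, hchild⟩ := he
    set j := e.2.1
    set b := e.2.2
    have hF := step_F_eq_compact_child q e.1 j b hs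
    -- the answer is an equimultiple point and the child is non-zero
    have heq : IsEquimultiplePoint q e.1 j b s := by
      rw [isEquimultiplePoint_iff_isPermissibleCentre_univ_step, hF]
      exact (isPermissibleCentre_iff q _ _).mpr hpc
    have hne : (step q e.1 j b s).F ≠ 0 := by
      rw [hF, Ne, evalT_eq_zero_iff, hnz]
      exact Bool.false_ne_true
    refine ⟨step q e.1 j b s, ⟨j, b, hj, hbj, hβ, heq, hne, rfl⟩, ?_⟩
    unfold lchildOK at hchild
    obtain ⟨r, hr, hrc⟩ := List.any_eq_true.mp hchild
    rw [Bool.and_eq_true, decide_eq_true_eq, Bool.and_eq_true] at hrc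
    have hrF : (step q e.1 j b s).F = evalT r.1 := by rw [hF]; exact (evalT_eq_iff_equivB _ _).mpr hrc.2.2
    exact ih r hr (by omega) _ hrF

/-- **Root-centre reading, A's side**: a passing win row of depth `d ≥ 1` whose origin is `q`-fold names a
permissible centre all of whose `β`-answers are won within `d − 1` — its centre is a first move of a `d`-move win.
[folklore] -/
theorem answers_win_of_wrowOK {q : ℕ} {β : Finset (Fin 4) → Fin 4 → (Fin 4 → K) → Bool} {W : List (WRow K)}
    (hW : ∀ row ∈ W, wrowOK q β W row = true) {row : WRow K} (hrow : row ∈ W)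
    (hq : permB q Finset.univ row.1 = true) {s : State K} (hs : s.F = evalT row.1) :
    IsPermissibleCentre q row.2.1 s.F ∧ ∀ s', RSucc q β s row.2.1 s' → ResWinsIn q β (row.2.2 - 1) s' := by
  have h := hW row hrow
  unfold wrowOK at h
  rw [hq, Bool.or_eq_true, Bool.and_eq_true, Bool.and_eq_true, decide_eq_true_eq, decide_eq_true_eq] at h
  rcases h with h | ⟨⟨-, hS⟩, hall⟩
  · exact absurd h (by decide)
  refine ⟨by rw [hs]; exact (isPermissibleCentre_iff q _ _).mpr hS, ?_⟩
  rintro s' ⟨j, b, hj, hbj, hβ, heq, hne, rfl⟩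
  have h := hall j hj b hbj
  unfold wreplyOK at h
  rw [Bool.or_eq_true, Bool.or_eq_true, Bool.or_eq_true] at h
  have hF := step_F_eq_compact_child q row.2.1 j b hs
  have heq' : IsEquimultiplePoint q row.2.1 j b (sd row.1).toState :=
    (FlatAbsorb.isEquimultiplePoint_congr q row.2.1 j b (by rw [hs, sd_toState_F])).mp heq
  rcases h with (h0 | h1) | (h2 | h3)
  · rw [Bool.not_eq_true'] at h0
    rw [h0] at hβ
    exact absurd hβ Bool.false_ne_true
  · rw [Bool.not_eq_true'] at h1
    exact absurd (equiHB_of_isEquimultiplePoint heq') (by rw [h1]; exact Bool.false_ne_true)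
  · exact absurd (by rw [hF, (evalT_eq_iff_equivB _ _).mpr h2, evalT_nil]) hne
  · unfold wchildOK at h3
    obtain ⟨r, hr, hrc⟩ := List.any_eq_true.mp h3
    rw [Bool.and_eq_true, decide_eq_true_eq, Bool.and_eq_true] at hrc
    have hrF : (step q row.2.1 j b s).F = evalT r.1 := by rw [hF]; exact (evalT_eq_iff_equivB _ _).mpr hrc.2.2
    exact (resWinsIn_of_wrowOK hW r hr _ hrF).mono hrc.1

omit [Fintype K] in
/-- **Root-centre reading, B's side**: a table entry passing `lreplyOK q β T L d S` against a sound loss table `T`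
names a `β`-answer to `S` from which A does not win within `d` — opening with `V(z, x_S)` costs at least `d + 2`
moves. [folklore] -/
theorem exists_answer_not_win_of_lreplyOK {q : ℕ} {β : Finset (Fin 4) → Fin 4 → (Fin 4 → K) → Bool}
    {T : List (LRow K)} (hT : ∀ row ∈ T, lrowOK q β T row = true) {L : Terms 4 K} {d : ℕ} {S : Finset (Fin 4)}
    {jb : Fin 4 × (Fin 4 → K)} (h : lreplyOK q β T L d S jb = true) {s : State K} (hs : s.F = evalT L) :
    ∃ s', RSucc q β s S s' ∧ ¬ ResWinsIn q β d s' := by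
  unfold lreplyOK lchildStep at h
  simp only [Bool.and_eq_true, decide_eq_true_eq, Bool.not_eq_true'] at h
  obtain ⟨⟨⟨hj, hbj⟩, hβ⟩, ⟨hpc, hnz⟩, hchild⟩ := h
  have hF := step_F_eq_compact_child q S jb.1 jb.2 hs
  have heq : IsEquimultiplePoint q S jb.1 jb.2 s := by
    rw [isEquimultiplePoint_iff_isPermissibleCentre_univ_step, hF]
    exact (isPermissibleCentre_iff q _ _).mpr hpc
  have hne : (step q S jb.1 jb.2 s).F ≠ 0 := by
    rw [hF, Ne, evalT_eq_zero_iff, hnz]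
    exact Bool.false_ne_true
  refine ⟨step q S jb.1 jb.2 s, ⟨jb.1, jb.2, hj, hbj, hβ, heq, hne, rfl⟩, ?_⟩
  unfold lchildOK at hchild
  obtain ⟨r, hr, hrc⟩ := List.any_eq_true.mp hchild
  rw [Bool.and_eq_true, decide_eq_true_eq, Bool.and_eq_true] at hrc
  have hrF : (step q S jb.1 jb.2 s).F = evalT r.1 := by rw [hF]; exact (evalT_eq_iff_equivB _ _).mpr hrc.2.2
  exact fun hw => not_resWinsIn_of_lrowOK hT r hr _ hrF (hw.mono hrc.1)

end Cert

/-! ## 4. Acceptance: idea-2's smallest anti-monotone pair (TRAVEL game over `𝔽₂`) -/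

section Model

/-- Win table for `x₃x₄ + x₂²x₃x₄` (value 2): A opens with `V(z, x₃, x₄)`; the two surviving children `x₂²x₄`,
`x₂²x₃` (cleaned charts) are killed by their divisor. (`certs-g11/small-travel-rho2.json`, A-table.) [folklore] -/
def smallWin : List (WRow (ZMod 2)) :=
  [([(![0, 0, 1, 1], 1), (![0, 2, 1, 1], 1)], {2, 3}, 2), ([(![0, 2, 0, 1], 1)], {1}, 1), ([(![0, 2, 1, 0], 1)], {1}, 1)]

/-- Loss table for `x₃x₄ + x₂²x₃x₄` at depth 1: against each of the four permissible centres B names an answer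
keeping the origin 2-fold. (`certs-g11/small-travel-rho2.json`, B-table.) [folklore] -/
def smallLoss : List (LRow (ZMod 2)) :=
  [([(![0, 0, 1, 1], 1), (![0, 2, 1, 1], 1)], 1,
      [({2, 3}, 2, ![0, 1, 0, 0]), ({0, 2, 3}, 0, ![0, 0, 0, 0]), ({1, 2, 3}, 1, ![0, 0, 0, 0]),
       ({0, 1, 2, 3}, 0, ![0, 0, 0, 0])]),
   ([(![0, 2, 0, 1], 1)], 0, []), ([(![0, 2, 1, 0], 1)], 0, []), ([(![0, 0, 1, 1], 1), (![2, 2, 1, 1], 1)], 0, [])]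

/-- The win table passes. [folklore] -/
theorem wrowOK_smallWin : ∀ row ∈ smallWin, wrowOK 2 (fun _ _ _ => true) smallWin row = true := by
  decide

/-- The loss table passes. [folklore] -/
theorem lrowOK_smallLoss : ∀ row ∈ smallLoss, lrowOK 2 (fun _ _ _ => true) smallLoss row = true := by
  decide

/-- **VALUE 2**: from every state with `F = x₃x₄ + x₂²x₃x₄` player A wins the TRAVEL game over `𝔽₂` within 2 moves
and not within 1. [OURS · ‖ K · 𝔽₂-rational answers only] [folklore] -/
theorem value_small (s : State (ZMod 2)) (hs : s.F = evalT [(![0, 0, 1, 1], 1), (![0, 2, 1, 1], 1)]) :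
    ResWinsIn 2 (fun _ _ _ => true) 2 s ∧ ¬ ResWinsIn 2 (fun _ _ _ => true) 1 s :=
  ⟨resWinsIn_of_wrowOK wrowOK_smallWin _ List.mem_cons_self s hs,
    not_resWinsIn_of_lrowOK lrowOK_smallLoss _ List.mem_cons_self s hs⟩

/-- Win table for the shift `x₃x₄ + x₂²x₃³x₄` (value 1): `V(z, x₃, x₄)` wins at once.
(`certs-g11/smallshift-travel-rho1.json`, A-table.) [folklore] -/
def shiftWin : List (WRow (ZMod 2)) :=
  [([(![0, 0, 1, 1], 1), (![0, 2, 3, 1], 1)], {2, 3}, 1)]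

/-- Loss rows of depth 0 for the shift and for its child under `V(z, x₁, x₃, x₄)`, chart `x₁`, origin (both origins
are 2-fold). (`certs-g11/smallshift-travel-rho1.json`, root-centre table.) [folklore] -/
def shiftLoss : List (LRow (ZMod 2)) :=
  [([(![0, 0, 1, 1], 1), (![0, 2, 3, 1], 1)], 0, []), ([(![0, 0, 1, 1], 1), (![2, 2, 3, 1], 1)], 0, [])]

/-- The shift's win table passes. [folklore] -/
theorem wrowOK_shiftWin : ∀ row ∈ shiftWin, wrowOK 2 (fun _ _ _ => true) shiftWin row = true := by
  decide

/-- The shift's loss rows pass. [folklore] -/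
theorem lrowOK_shiftLoss : ∀ row ∈ shiftLoss, lrowOK 2 (fun _ _ _ => true) shiftLoss row = true := by
  decide

/-- **VALUE 1** for the shift `x₃x₄ + x₂²x₃³x₄` (TRAVEL game over `𝔽₂`): won within 1 move, not within 0 — raising
one exponent LOWERED the value (idea-2's anti-monotone pair, P-2-2). [OURS · ‖ K · 𝔽₂-rational answers only]
[folklore] -/
theorem value_smallShift (s : State (ZMod 2)) (hs : s.F = evalT [(![0, 0, 1, 1], 1), (![0, 2, 3, 1], 1)]) :
    ResWinsIn 2 (fun _ _ _ => true) 1 s ∧ ¬ ResWinsIn 2 (fun _ _ _ => true) 0 s :=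
  ⟨resWinsIn_of_wrowOK wrowOK_shiftWin _ List.mem_cons_self s hs,
    not_resWinsIn_of_lrowOK lrowOK_shiftLoss _ List.mem_cons_self s hs⟩

/-- … and the centre `V(z, x₁, x₃, x₄)` is NOT optimal there: B's answer «chart `x₁`, origin» keeps the origin
2-fold, so opening with it costs `≥ 2` moves. [OURS · ‖ K] [folklore] -/
theorem smallShift_centre_refuted (s : State (ZMod 2))
    (hs : s.F = evalT [(![0, 0, 1, 1], 1), (![0, 2, 3, 1], 1)]) :
    ∃ s', RSucc 2 (fun _ _ _ => true) s {0, 2, 3} s' ∧ ¬ ResWinsIn 2 (fun _ _ _ => true) 0 s' :=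
  exists_answer_not_win_of_lreplyOK lrowOK_shiftLoss (d := 0) (S := {0, 2, 3})
    (jb := ((0 : Fin 4), (![0, 0, 0, 0] : Fin 4 → ZMod 2))) (by decide) hs

end Model

end ValueCert

end Summit.ResolutionOfSingularities.ResolutionOfSingularities.Theorems.PIDim4

end
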